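import Summits.SmoothPoincare4.SmoothPoincare4.Theses.CutLocusSpine
import Literature.Topology.FourManifolds.CerfGammaFour

/-!
# Birth skeleton — crux `RungFour` (item `stmt-SmoothPoincare4-11119`), line `birth`

Route `route-SmoothPoincare4-CutLocusSpine` ("Comb the cut locus"), rank-3 crux
`Summit.SmoothPoincare4.SmoothPoincare4.Theses.CutLocusSpine.RungFour`:

> a homotopy 4-sphere `(M, e : M ≃ₕ S⁴)` carrying a smooth Riemannian metric `g` and a point `p` whose metric cut
> locus `Cut_g(p)` is triangulable and whose minimal-geodesic multiplicity (midpoint count) is `≤ 4` everywhere is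
> diffeomorphic to `S⁴`.

THE LINE is the route header's own reading of the crux ("recognition goes through the CLOSED THICKENING of the
spine", BARRIERS/OpenAnalogueBarrierFour; two-layer plan "VertexFreeSpines: a homotopy 4-ball with a simple 3-spine
having no 5-fold points is B⁴"). Fix a small radius `r` (below the injectivity radius at `p`). The closed geodesic
ball `B̄(p,r) = {d(p,·) ≤ r}` is a smoothly embedded 4-disc, and `M = B̄(p,r) ∪ F_r` with the FAR REGION
`F_r = {x | r ≤ d(p,x)}`; the two pieces meet along the geodesic sphere `{d = r} ≅ S³`. The far region is the
mapping cylinder of the cut map `S³ → Cut_g(p)`, `u ↦ exp_p(t_c(u)·u)` (fibres = minimal-geodesic multiplicity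
`≤ 4`, image = the tame polyhedron `Cut_g(p)`): it is the radial thickening of the spine, a compact contractible
smooth 4-manifold with boundary `S³` collapsing radially onto `Cut_g(p)`, and ALL the exoticness of `M` lives in it
(`M ∖ Cut_g(p)` is an open 4-ball for every `M`). So:

* `stub_farRegionDisc` (THE HEART, the vertex-free-spine recognition in metric clothes; open-problem strength,
  SPC4-implied like the crux itself — BARRIERS §D.1): under the hypotheses of `RungFour`, for all sufficiently small
  `r > 0` the far region `{x | r ≤ d(p,x)}` is the range of a smooth embedding of the closed unit 4-disc `𝔻⁴`
  (manifold with boundary, model `𝓡∂ 4`, the tree's `ClosedBall.lean` instances). Intended attack (route card):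
  tame + `N ≤ 4` ⇒ `Cut_g(p)` is a simple 3-polyhedron WITHOUT VERTICES (no `A₁⁵` points) whose free faces are the
  conjugate rib; collapse it sheet by sheet from the rib and cover each elementary collapse by a smooth shelling of
  `F_r` along the radial product structure — never touching `p`.
* `stub_twistedSphere_of_farRegionDisc` (Riemannian gluing geometry; a THEOREM, size L): for ANY smooth Riemannian
  metric on a Hausdorff 4-manifold `M` and any `p`, if for arbitrarily small `r > 0` the far region is a smoothly
  embedded closed 4-disc, then `M` is a twisted sphere `D⁴ ∪_φ D⁴` in the tree's sense
  (`Literature.Topology.FourManifolds.IsTwistedSphere 3 φ M`): for `r` below the injectivity radius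
  `a ↦ exp_p(r·a)` embeds `𝔻⁴` onto `{d ≤ r}` (Gauss lemma; metric balls = geodesic balls, tree
  `GeodesicBallsMetric.lean`; restriction of a partial diffeomorphism to `𝔻⁴` is an `𝓡∂ 4`-embedding, tree
  `isSmoothEmbedding_comp_coe_closedBall`), both discs send `∂𝔻⁴` onto `{d = r}` (invariance of domain), and
  `φ := (j_far|∂)⁻¹ ∘ (j_near|∂)` is a diffeomorphism of `S³` (bijective immersion between closed 3-manifolds).
* `stub_cerfGammaFour` (a THEOREM, formal debt XL): Cerf's `Γ₄ = 0` in twisted-sphere form — BY NAME the tree's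
  named fact `Literature.Topology.FourManifolds.cerf_twistedSphere_four` (every `TwistedSphere 3 φ` has carrier
  `≅ S⁴`; Cerf 1968, Kervaire–Milnor 1963 §1); verbatim the body of item `SchsplitCerf`
  (stmt-SmoothPoincare4-8758) of route SchoenfliesSplit, so it closes the day either lands. The route's Cerf-free
  alternative (matching radial data with the 4-ellipsoid, ItohKiyohara2010 Thm 7.1) would replace this stub.

`RungFour_of : stub₁-sig → stub₂-sig → stub₃-sig → RungFour` is the REAL composition (sorry-free, standard axioms):
the heart gives the far disc eventually in `r`, hence frequently (`𝓝[>] 0` is non-trivial); the gluing stub makes `M`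
a twisted sphere; `M` is then compact (`IsTwistedSphere.compactSpace`) and is bundled as a
`Literature.Topology.FourManifolds.TwistedSphere 3 φ`, to which Cerf's fact applies. Its hypotheses are the stub
statements under the name-keyed aliases `Registered.stub_*` (device of `ValiantsHypothesis/…/TauBurgisserDet/Lines/
birth.lean`: `#h21_check_skeleton` admits hypotheses that are declared stubs BY NAME); the closing `example : RungFour`
wires the three sorried stubs into it. `sorry` occurs ONLY in the three `stub_*` theorems.

Disproof used: none — `ledger crux ls stmt-SmoothPoincare4-11119` showed no workfiles (no `Disproof.lean`, no
`_false_without_` theorem, no `Theorems/RungFour/Negative/*`) at registration (2026-08-17). Negatives index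
(`ledger negatives --problem SmoothPoincare4`): no statement about cut loci / geodesic multiplicity / far regions.
Refuter evidence on the item (2026-08-15): `SmoothPoincare4 → RungFour` (the crux and `stub_farRegionDisc` are
SPC4-shielded: a refutation is an exotic `S⁴`), `RungFour → RungThree → RungTwo`. Load-bearing hypotheses of the
heart: `e` (round `ℝℙ⁴`: `Cut = ℝℙ³`, `N ≡ 2`, far region = tubular neighbourhood of `ℝℙ³`, not a disc), the bound
`N ≤ 4` (without it the statement is SPC4 for `C^ω` metrics, Buchner 1977). Barriers: TwistedSphereBarrierFour is
used positively only (Cerf); OpenAnalogueBarrierFour respected (the disc to recognise is the CLOSED far region, not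
`M ∖ Cut` or `M ∖ {p}`); HCobordismBarrierFour not invoked.
-/

set_option linter.dupNamespace false

noncomputable section

open scoped Manifold ContDiff Topology ENNReal
open Set Filter

namespace Summit.SmoothPoincare4.SmoothPoincare4.Cruxes.RungFour.Birth

open Summit.SmoothPoincare4.SmoothPoincare4.Theses.CutLocusSpine (RungFour)

/-! ## The three registered stubs -/

/-- **Stub 1 (THE HEART) — the far region of a tame, multiplicity-`≤ 4` cut locus is a smooth 4-disc.**
For a homotopy 4-sphere `(M, e)` with a smooth Riemannian metric `g` and a point `p` whose metric cut locus
`{q ≠ p | ∀ r, d(p,r) = d(p,q) + d(q,r) → r = q}` is the homeomorphic image of a finite simplicial complex and whose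
midpoint counts are `≤ 4` (exactly the hypotheses of `RungFour`), for all sufficiently small `r > 0` the far region
`{x | r ≤ d(p,x)}` — the radial thickening (mapping cylinder of the cut map) of the vertex-free polyhedron `Cut_g(p)`
— is the range of a smooth embedding of the closed unit disc `𝔻⁴ ⊂ ℝ⁴` (model with boundary `𝓡∂ 4`).
Why plausibly true: it is implied by SPC4 (on `S⁴` the complement of a small open geodesic ball is a disc, Palais);
its content is the recognition of the thickening of a simple 3-polyhedron without `A₁⁵` vertices (route card item
VertexFreeSpines). Why it might fail: exactly the crux's own risk (no classification of vertex-free simple 3-spines of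
homotopy 4-balls; degenerate caustic points with `N ≤ 4`). Size: open-problem.
[cite: Buchner1978] [cite: AnguloGuijarro2011] [cite: Matveev2000] -/
theorem stub_farRegionDisc :
    ∀ (M : Type) [TopologicalSpace M] [T2Space M] [SecondCountableTopology M]
      [ChartedSpace (EuclideanSpace ℝ (Fin 4)) M] [IsManifold (𝓡 4) ∞ M],
      ContinuousMap.HomotopyEquiv M (Metric.sphere (0 : EuclideanSpace ℝ (Fin 5)) 1) →
      ∀ (g : Literature.Geometry.Lorentzian.PseudoRiemannianMetric (𝓡 4) ∞ (EuclideanSpace ℝ (Fin 4))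
          (TangentSpace (𝓡 4) : M → Type _)) (hg : g.IsRiemannian) (p : M),
        (∃ (k : ℕ) (K : Geometry.SimplicialComplex ℝ (EuclideanSpace ℝ (Fin k))) (φ : K.space → M),
            K.faces.Finite ∧ Topology.IsEmbedding φ ∧
              Set.range φ = {q : M | q ≠ p ∧ ∀ r : M,
                g.edist hg p r = g.edist hg p q + g.edist hg q r → r = q}) →
        (∀ q : M, ({m : M | g.edist hg p m = g.edist hg m q ∧
            g.edist hg p m + g.edist hg m q = g.edist hg p q}).encard ≤ 4) →
        ∀ᶠ r : ℝ in 𝓝[>] 0,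
          ∃ j : (Metric.closedBall (0 : EuclideanSpace ℝ (Fin 4)) 1) → M,
            Manifold.IsSmoothEmbedding (𝓡∂ 4) (𝓡 4) ∞ j ∧
              Set.range j = {x : M | ENNReal.ofReal r ≤ g.edist hg p x} := by
  sorry

/-- **Stub 2 — near ball plus far disc is a twisted sphere (Riemannian gluing geometry).**
For any smooth Riemannian metric `g` on a Hausdorff second-countable smooth 4-manifold `M` and any `p ∈ M`: if for
arbitrarily small `r > 0` the far region `{x | r ≤ d(p,x)}` is the range of a smooth embedding of `𝔻⁴`, then `M` is
a twisted sphere `D⁴ ∪_φ D⁴` (`IsTwistedSphere 3 φ M`: a boundary gluing of two copies of the tree's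
`closedBallBoundaryData 3`). Proof route: take such an `r` below the injectivity radius at `p`; the near disc
`a ↦ exp_p(r·a)` is a smooth `𝓡∂ 4`-embedding of `𝔻⁴` with range `{d ≤ r}` (Gauss lemma, metric balls are
geodesic balls for small radii; restriction of a partial diffeomorphism to the closed ball); the two ranges cover
`M`; by invariance of domain both discs carry `∂𝔻⁴ = S³` onto the geodesic sphere `{d = r}` and their interiors
into `{d < r}`, `{d > r}`; `φ := (j_far ∘ incl)⁻¹ ∘ (j_near ∘ incl)` is a bijective immersion `S³ → S³`, hence a
diffeomorphism, and the two embeddings meet exactly along `incl z ↔ incl (φ z)`.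
Why plausibly true: it is a theorem of elementary Riemannian geometry + differential topology (Hirsch 1976 §8.2;
Milnor 1965 §1). Size: L (formal). No homotopy hypothesis is needed or used.
[cite: Hirsch1976, §8.2] [cite: KervaireMilnor1963, §1] -/
theorem stub_twistedSphere_of_farRegionDisc :
    ∀ (M : Type) [TopologicalSpace M] [T2Space M] [SecondCountableTopology M]
      [ChartedSpace (EuclideanSpace ℝ (Fin 4)) M] [IsManifold (𝓡 4) ∞ M]
      (g : Literature.Geometry.Lorentzian.PseudoRiemannianMetric (𝓡 4) ∞ (EuclideanSpace ℝ (Fin 4))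
          (TangentSpace (𝓡 4) : M → Type _)) (hg : g.IsRiemannian) (p : M),
        (∃ᶠ r : ℝ in 𝓝[>] 0,
          ∃ j : (Metric.closedBall (0 : EuclideanSpace ℝ (Fin 4)) 1) → M,
            Manifold.IsSmoothEmbedding (𝓡∂ 4) (𝓡 4) ∞ j ∧
              Set.range j = {x : M | ENNReal.ofReal r ≤ g.edist hg p x}) →
        ∃ φ : (Metric.sphere (0 : EuclideanSpace ℝ (Fin 4)) 1) ≃ₘ⟮𝓡 3, 𝓡 3⟯
            (Metric.sphere (0 : EuclideanSpace ℝ (Fin 4)) 1),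
          Literature.Topology.FourManifolds.IsTwistedSphere 3 φ M := by
  sorry

/-- **Stub 3 — Cerf's `Γ₄ = 0`, twisted-sphere form, BY NAME the tree's named fact**
`Literature.Topology.FourManifolds.cerf_twistedSphere_four`: every twisted 4-sphere `D⁴ ∪_φ D⁴` (any bundled
`TwistedSphere 3 φ`) is diffeomorphic to `S⁴` (Cerf 1968, main theorem; Kervaire–Milnor 1963 §1). Verbatim the
body of the SchoenfliesSplit item `SchsplitCerf` (stmt-SmoothPoincare4-8758); the tree already reduces the fact to
`π₀ Diff(D³ rel ∂) = 0`. Why plausibly true: it is a theorem. Size: XL (formal debt, no research content).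
[cite: Cerf1968, main theorem (Γ₄ = 0)] [cite: KervaireMilnor1963, §1] -/
theorem stub_cerfGammaFour : Literature.Topology.FourManifolds.cerf_twistedSphere_four := by
  sorry

/-! ## Name-keyed aliases of the three stub statements (hypotheses of the composition) -/
namespace Registered

/-- Alias: the signature of `stub_farRegionDisc`. -/
abbrev stub_farRegionDisc : Prop :=
    ∀ (M : Type) [TopologicalSpace M] [T2Space M] [SecondCountableTopology M]
      [ChartedSpace (EuclideanSpace ℝ (Fin 4)) M] [IsManifold (𝓡 4) ∞ M],
      ContinuousMap.HomotopyEquiv M (Metric.sphere (0 : EuclideanSpace ℝ (Fin 5)) 1) →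
      ∀ (g : Literature.Geometry.Lorentzian.PseudoRiemannianMetric (𝓡 4) ∞ (EuclideanSpace ℝ (Fin 4))
          (TangentSpace (𝓡 4) : M → Type _)) (hg : g.IsRiemannian) (p : M),
        (∃ (k : ℕ) (K : Geometry.SimplicialComplex ℝ (EuclideanSpace ℝ (Fin k))) (φ : K.space → M),
            K.faces.Finite ∧ Topology.IsEmbedding φ ∧
              Set.range φ = {q : M | q ≠ p ∧ ∀ r : M,
                g.edist hg p r = g.edist hg p q + g.edist hg q r → r = q}) →
        (∀ q : M, ({m : M | g.edist hg p m = g.edist hg m q ∧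
            g.edist hg p m + g.edist hg m q = g.edist hg p q}).encard ≤ 4) →
        ∀ᶠ r : ℝ in 𝓝[>] 0,
          ∃ j : (Metric.closedBall (0 : EuclideanSpace ℝ (Fin 4)) 1) → M,
            Manifold.IsSmoothEmbedding (𝓡∂ 4) (𝓡 4) ∞ j ∧
              Set.range j = {x : M | ENNReal.ofReal r ≤ g.edist hg p x}

/-- Alias: the signature of `stub_twistedSphere_of_farRegionDisc`. -/
abbrev stub_twistedSphere_of_farRegionDisc : Prop :=
    ∀ (M : Type) [TopologicalSpace M] [T2Space M] [SecondCountableTopology M]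
      [ChartedSpace (EuclideanSpace ℝ (Fin 4)) M] [IsManifold (𝓡 4) ∞ M]
      (g : Literature.Geometry.Lorentzian.PseudoRiemannianMetric (𝓡 4) ∞ (EuclideanSpace ℝ (Fin 4))
          (TangentSpace (𝓡 4) : M → Type _)) (hg : g.IsRiemannian) (p : M),
        (∃ᶠ r : ℝ in 𝓝[>] 0,
          ∃ j : (Metric.closedBall (0 : EuclideanSpace ℝ (Fin 4)) 1) → M,
            Manifold.IsSmoothEmbedding (𝓡∂ 4) (𝓡 4) ∞ j ∧
              Set.range j = {x : M | ENNReal.ofReal r ≤ g.edist hg p x}) →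
        ∃ φ : (Metric.sphere (0 : EuclideanSpace ℝ (Fin 4)) 1) ≃ₘ⟮𝓡 3, 𝓡 3⟯
            (Metric.sphere (0 : EuclideanSpace ℝ (Fin 4)) 1),
          Literature.Topology.FourManifolds.IsTwistedSphere 3 φ M

/-- Alias: the signature of `stub_cerfGammaFour`. -/
abbrev stub_cerfGammaFour : Prop :=
    Literature.Topology.FourManifolds.cerf_twistedSphere_four

end Registered

/-! ## The composition (kernel-checked, sorry-free) -/

/-- **Skeleton theorem — the crux BY NAME from the three stubs.** Given the binders of `RungFour`
(`M`, `e : M ≃ₕ S⁴`, `g`, `hg`, `p`, tameness, `N ≤ 4`): the heart makes the far region a smooth 4-disc for all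
small radii, in particular for arbitrarily small ones; the gluing stub then presents `M` as a twisted sphere
`D⁴ ∪_φ D⁴`, which is compact and is bundled as a `TwistedSphere 3 φ`; Cerf's `Γ₄ = 0` gives `M ≅ S⁴`.
[cite: KervaireMilnor1963, §1] [cite: Cerf1968, main theorem (Γ₄ = 0)] -/
theorem RungFour_of :
    Registered.stub_farRegionDisc → Registered.stub_twistedSphere_of_farRegionDisc →
      Registered.stub_cerfGammaFour → RungFour := by
  intro hFar hGlue hCerf M _ _ _ _ _ e g hg p hT hN
  -- the far region is a disc for all small radii, hence for arbitrarily small ones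
  have hdisc := (hFar M e g hg p hT hN).frequently
  -- near ball + far disc: `M` is a twisted sphere `D⁴ ∪_φ D⁴`
  obtain ⟨φ, hφ⟩ := hGlue M g hg p hdisc
  -- a twisted sphere is compact; bundle it and apply Cerf's `Γ₄ = 0`
  haveI : CompactSpace M := hφ.compactSpace
  have hC : Literature.Topology.FourManifolds.cerf_twistedSphere_four := hCerf
  exact hC φ { carrier := M, isTwistedSphere := hφ }

/-- Wiring check: the three registered stubs feed `RungFour_of` exactly as stated (aliases = signatures), so the
skeleton is `RungFour` closed modulo the stubs; sorries enter only through them. -/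
example : RungFour :=
  RungFour_of stub_farRegionDisc stub_twistedSphere_of_farRegionDisc stub_cerfGammaFour

end Summit.SmoothPoincare4.SmoothPoincare4.Cruxes.RungFour.Birth

end
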